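import Summits.QuantumFields.YangMills.Theorems.BalabanUVNodesN06Row17LocalClauseOnReg335OfL5Letters
import Summits.QuantumFields.YangMills.Theorems.BalabanUVNodesN06Row17LocalCentreOfLemma24Letter

/-!
# BalabanUVNodes ∕ N06 ([B9], `Dag.B9_main`) — ROW 17's LOCAL CLAUSE ON PRINT'S CLASS (3.35) AT A ONE-LEVEL `□̃(c)` WITH THE CENTRE NUMBER BUILT IN:
# `hloc(U)` from L5's pencil letters ALONE — the `hco` binder of `…LocalClauseOnReg335OfL5Letters.posDefTr_padDeltaALocY_of_L5_of_regYP335` supplied by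
# `…LocalCentreOfLemma24Letter.coer_trIP_padDeltaALocY_one_cubeDomY_of_oneLevel_of_lev` (ROAD «C» W0 (b)); top-torus members: every cube

Track A of `YM-PLAN.md` (cell `pub-ymgap`, HUMAN RULING D-0062), node **N06** = [Balaban1985BackgroundPropagators] Thms 3.1–3.15; seat `pub-ymgap-dag-n06-j`
(bundle F5, rows 15–17), g24.  A HELPER (count-neutral, `--supports` only).

THE PRINT.  [B9] p. 416 (proof of Thm 3.11): *«by (3.86) we get G_□(e^{iηA}) = G_□(1)(I − V(A)G_□(1))⁻¹. In [4] we have proved that the operator G_□(1) is positive,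
hence by the same reasoning as above we prove positivity of G_□»*; [4] = [Balaban1984PropagatorsII] p. 226, p. 239 («G_□ = G_j on the torus»).

WHAT.  ★★★ `posDefTr_padDeltaALocY_of_L5_of_regYP335_oneLevel`: for `U` in print's class (3.35) (`bg9YP … Reg335 cthr α₀ U`, `cthr ≤ 10`), a member `x`, a cover
cube `c` whose enlarged cube `□̃(c)` is ONE-LEVEL (`hone`) with NO DEEPER NEIGHBOUR (`hNbrLev`), 0∕1 cuts `χP`, `χ` with `χ` issuing from `□̃(c)`, `0 < b₀`:
**`PosDefTr 1 (padDeltaALocY x.toKIdx parSymY parBY (cubeDomY x c) (cutMulY χP) (cutMulY χ) U)`** from L5's pencil letters `hA`, the fibre count `hfib`, the radius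
inequalities `hR′ hR′R`, `hsmall` (now at the EXPLICIT centre number `m_□ = min 1 γ(κ_j, π)`), and the (3.35) comparison `hCr` — the `hco` binder is GONE.
★★★ `posDefTr_padDeltaALocY_of_L5_of_regYP335_top`: top-torus members (`lev ≡ k`), every cube.
HONEST FRAMING.  A two-theorem composition; L5's analytic letters stay displayed; the cube scope (`hone`, `hNbrLev`) displayed; COUNT-NEUTRAL; N06 ∕ N10 NOT discharged;
nothing continuum ∕ OS ∕ mass gap ∕ Clay.  0 `def`, 0 `sorry`.
-/

noncomputable section

namespace Summit.QuantumFields.YangMills.BalabanUVNodes.N06Row17LocalClauseOnReg335OneLevel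

open Finset
open Literature.MathematicalPhysics.QuantumFieldTheory.Balaban1983to89
open Literature.MathematicalPhysics.QuantumFieldTheory.Balaban1983to89.Node00
open Literature.MathematicalPhysics.QuantumFieldTheory.Balaban1983to89.Node00.OpsYDeltaALocal (padDeltaALocY)
open Literature.MathematicalPhysics.QuantumFieldTheory.Balaban1983to89.B6KLevelCensusIndexV1 (KIdx kGeo)
open Literature.MathematicalPhysics.QuantumFieldTheory.Balaban1983to89.B6GlobalChartV1 (PV boxEquiv toBox)
open Literature.MathematicalPhysics.QuantumFieldTheory.Balaban1983to89.B9BackgroundsKLevelV1 (CfgV1)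
open Literature.MathematicalPhysics.QuantumFieldTheory.Balaban1983to89.B9BackgroundsKLevelV1P (bg9YP)
open Literature.MathematicalPhysics.QuantumFieldTheory.Balaban1983to89.B9PinMembersKLevelV1 (MemberY)
open Literature.MathematicalPhysics.QuantumFieldTheory.Balaban1983to89.B6Cover236MultiLevelBlocks (cubes)
open Literature.MathematicalPhysics.QuantumFieldTheory.Balaban1983to89.B9WalkLettersCoordsS (cubeDomY)
open Literature.MathematicalPhysics.QuantumFieldTheory.Balaban1983to89.B9Thm37CubeCoverCommutators (cutMulY)
open Literature.MathematicalPhysics.QuantumFieldTheory.Balaban1983to89.B9Thm311ReadingCoords (trIP PosDefTr)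
open Literature.MathematicalPhysics.QuantumFieldTheory.Balaban1983to89.LatticeNorms (scaleLen)
open Literature.MathematicalPhysics.QuantumFieldTheory.Balaban1983to89.B5TorusCover (UT)
open Literature.MathematicalPhysics.QuantumFieldTheory.Balaban1983to89.B13EntrywiseWalks (RawEntryLetters)
open Literature.MathematicalPhysics.QuantumFieldTheory.Balaban1983to89.B9Eq39Adjoint (prodCfg)
open Literature.MathematicalPhysics.QuantumFieldTheory.Balaban1983to89.B5Eq118OneStroke (iterBlockOf)
open Literature.MathematicalPhysics.QuantumFieldTheory.Balaban1983to89.Node00.OpsYNablaBridge (chartY)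
open Summit.QuantumFields.YangMills.BalabanUVNodes.N06Row17LocalClauseOnReg335OfL5 (posDefTr_padDeltaALocY_of_L5_of_regYP335)
open Summit.QuantumFields.YangMills.BalabanUVNodes.N06Row17LocalCentreOfLemma24 (coer_trIP_padDeltaALocY_one_cubeDomY_of_oneLevel_of_lev
  coer_trIP_padDeltaALocY_one_cubeDomY_of_lev_eq_top)
open scoped Matrix
open scoped Matrix.Norms.L2Operator

variable {N : ℕ} {d ℓ : ℕ} {hd : 1 ≤ d + 1} {hL : Odd (ℓ + 1) ∧ 1 < ℓ + 1} {b₀ b₁ : ℝ} {Mstar : ℕ}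
variable {ν : ℕ} {Nf : Fin ν → ℕ} [∀ j, NeZero (Nf j)]

/-- ★★★ **ROW 17's LOCAL CLAUSE ON (3.35) AT A ONE-LEVEL `□̃(c)`, CENTRE NUMBER BUILT IN**: `hloc(U)` for `U` in print's class from L5's pencil letters, the fibre
count, the radius inequalities at the EXPLICIT `m_□ = min 1 γ`, and the (3.35) comparison — for a one-level enlarged cube with no deeper neighbour, 0∕1 cuts with
`χ` issuing from `□̃(c)`, `0 < b₀`. [cite: Balaban1985BackgroundPropagators, Thm 3.11 proof p.416, Cor. 3.6 p.408, (3.35) p.396, pp.408–410; Balaban1984PropagatorsII, p.226, p.239, Lemma 2.4 (2.128) p.245; Balaban1988RG2Cluster, p.15] -/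
theorem posDefTr_padDeltaALocY_of_L5_of_regYP335_oneLevel [Nonempty (Fin N)] {G : Subgroup (Matrix (Fin N) (Fin N) ℂ)ˣ}
    (x : MemberY d ℓ hd hL b₀ b₁ Mstar) (c : ↥(cubes x.toKIdx.D.toDomains)) {χP : BlkY x.toKIdx → ℝ} (hχP : ∀ y, χP y = 0 ∨ χP y = 1)
    {χ : FBondY x.toKIdx → ℝ} (hχ : ∀ b, χ b = 0 ∨ χ b = 1) (hχD : ∀ b, χ b ≠ 0 → boxEquiv x.toKIdx.hN b.src ∈ cubeDomY x c)
    (hd2 : 2 ≤ d + 1) {j : ℕ} (hj : j ≤ x.m + x.K) (hone : ∀ z ∈ cubeDomY x c, x.toKIdx.D.lev z.1 = j)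
    (hNbrLev : ∀ bb : PBond (PV d ℓ x.m x.K hd hL) j,
      (∃ y : Site (PV d ℓ x.m x.K hd hL) 0, (iterBlockOf j y = bb.src ∨ iterBlockOf j y = bb.tgt) ∧ chartY x.toKIdx y ∈ cubeDomY x c) →
      ∀ y : Site (PV d ℓ x.m x.K hd hL) 0, (iterBlockOf j y = bb.src ∨ iterBlockOf j y = bb.tgt) →
        x.toKIdx.D.lev (toBox x.toKIdx.hN y : Fin (d + 1) → ℤ) ≤ j)
    (hb₀ : 0 < b₀)
    {cthr α₀ : ℝ} (hc : cthr ≤ 10) (hα : 0 ≤ α₀) {U : CfgV1 (PV d ℓ x.m x.K hd hL) (Matrix (Fin N) (Fin N) ℂ)}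
    (hreg : (bg9YP (Matrix (Fin N) (Fin N) ℂ) G x).Reg335 cthr α₀ U)
    {loc : FBondY x.toKIdx × (Fin N × Fin N) → UT Nf} {R R' ρ B : ℝ}
    (hA : RawEntryLetters (fun a : Fin (d + 1) → Site (PV d ℓ x.m x.K hd hL) 0 → Matrix (Fin N) (Fin N) ℂ =>
      LinearMap.toMatrix
        ((Pi.basis fun _ : FBondY x.toKIdx => Matrix.stdBasis ℂ (Fin N) (Fin N)).reindex (Equiv.sigmaEquivProd (FBondY x.toKIdx) (Fin N × Fin N)))
        ((Pi.basis fun _ : FBondY x.toKIdx => Matrix.stdBasis ℂ (Fin N) (Fin N)).reindex (Equiv.sigmaEquivProd (FBondY x.toKIdx) (Fin N × Fin N)))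
        (padDeltaALocY x.toKIdx (parSymY x.toKIdx) (parBY x.toKIdx) (cubeDomY x c) (cutMulY χP) (cutMulY χ)
          (prodCfg (1 : CfgY (Matrix (Fin N) (Fin N) ℂ) x.toKIdx) (kGeo x.toKIdx).eta a))) loc R ρ B)
    (hρ : 0 < ρ) {mF : ℕ} (hfib : ∀ y : UT Nf, (univ.filter fun k => loc k = y).card ≤ mF)
    (hR' : 0 < R') (hR'R : R' ≤ R)
    (hsmall : 2 * (B * (mF * B6.c0 1 ρ ^ ν)) * R' <
      min 1 (2 / (1 / (12 * (((d + 1 : ℕ) : ℝ)) ^ 2) * (((((ℓ + 1 : ℕ) : ℝ)) ^ j) ^ (d + 1 + 1))⁻¹ *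
              min (x.toKIdx.cf ^ 2) (b₀ * x.toKIdx.cf ^ 2 / ((((ℓ + 1 : ℕ) : ℝ)) ^ j) ^ (d + 1 - 2))) +
          4 / (8 * x.toKIdx.cf ^ 2 / ((((ℓ + 1 : ℕ) : ℝ)) ^ x.toKIdx.k) ^ 2) *
            (1 + 4 * ((d + 1 : ℕ) : ℝ) * x.toKIdx.cf ^ 2 /
              (1 / (12 * (((d + 1 : ℕ) : ℝ)) ^ 2) * (((((ℓ + 1 : ℕ) : ℝ)) ^ j) ^ (d + 1 + 1))⁻¹ *
                min (x.toKIdx.cf ^ 2) (b₀ * x.toKIdx.cf ^ 2 / ((((ℓ + 1 : ℕ) : ℝ)) ^ j) ^ (d + 1 - 2)))))⁻¹ * R)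
    (hCr : 2 * (kGeo x.toKIdx).L ^ 4 * ((kGeo x.toKIdx).M * α₀) * (scaleLen (kGeo x.toKIdx).L (kGeo x.toKIdx).eta c.1.1)⁻¹ ≤ R') :
    PosDefTr (fun _ => (1 : ℝ)) (padDeltaALocY x.toKIdx (parSymY x.toKIdx) (parBY x.toKIdx) (cubeDomY x c) (cutMulY χP) (cutMulY χ) U) :=
  posDefTr_padDeltaALocY_of_L5_of_regYP335 x c χP hχD hc hα hreg hA hρ hfib
    (coer_trIP_padDeltaALocY_one_cubeDomY_of_oneLevel_of_lev x c hd2 hj hone hNbrLev hb₀ hχP hχ hχD) hR' hR'R hsmall hCr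

/-- ★★★ **THE SAME FOR TOP-TORUS MEMBERS, EVERY CUBE** (`lev ≡ k`: no cube scope needed).
[cite: Balaban1985BackgroundPropagators, Thm 3.11 proof p.416, Cor. 3.6 p.408, (3.35) p.396; Balaban1984PropagatorsII, p.224 («Ω_j = T_η»), p.226; Balaban1988RG2Cluster, p.15] -/
theorem posDefTr_padDeltaALocY_of_L5_of_regYP335_top [Nonempty (Fin N)] {G : Subgroup (Matrix (Fin N) (Fin N) ℂ)ˣ}
    (x : MemberY d ℓ hd hL b₀ b₁ Mstar) (c : ↥(cubes x.toKIdx.D.toDomains)) {χP : BlkY x.toKIdx → ℝ} (hχP : ∀ y, χP y = 0 ∨ χP y = 1)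
    {χ : FBondY x.toKIdx → ℝ} (hχ : ∀ b, χ b = 0 ∨ χ b = 1) (hχD : ∀ b, χ b ≠ 0 → boxEquiv x.toKIdx.hN b.src ∈ cubeDomY x c)
    (hd2 : 2 ≤ d + 1) (hlev : ∀ z : SiteY x.toKIdx, x.toKIdx.D.lev z.1 = x.toKIdx.k) (hb₀ : 0 < b₀)
    {cthr α₀ : ℝ} (hc : cthr ≤ 10) (hα : 0 ≤ α₀) {U : CfgV1 (PV d ℓ x.m x.K hd hL) (Matrix (Fin N) (Fin N) ℂ)}
    (hreg : (bg9YP (Matrix (Fin N) (Fin N) ℂ) G x).Reg335 cthr α₀ U)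
    {loc : FBondY x.toKIdx × (Fin N × Fin N) → UT Nf} {R R' ρ B : ℝ}
    (hA : RawEntryLetters (fun a : Fin (d + 1) → Site (PV d ℓ x.m x.K hd hL) 0 → Matrix (Fin N) (Fin N) ℂ =>
      LinearMap.toMatrix
        ((Pi.basis fun _ : FBondY x.toKIdx => Matrix.stdBasis ℂ (Fin N) (Fin N)).reindex (Equiv.sigmaEquivProd (FBondY x.toKIdx) (Fin N × Fin N)))
        ((Pi.basis fun _ : FBondY x.toKIdx => Matrix.stdBasis ℂ (Fin N) (Fin N)).reindex (Equiv.sigmaEquivProd (FBondY x.toKIdx) (Fin N × Fin N)))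
        (padDeltaALocY x.toKIdx (parSymY x.toKIdx) (parBY x.toKIdx) (cubeDomY x c) (cutMulY χP) (cutMulY χ)
          (prodCfg (1 : CfgY (Matrix (Fin N) (Fin N) ℂ) x.toKIdx) (kGeo x.toKIdx).eta a))) loc R ρ B)
    (hρ : 0 < ρ) {mF : ℕ} (hfib : ∀ y : UT Nf, (univ.filter fun k => loc k = y).card ≤ mF)
    (hR' : 0 < R') (hR'R : R' ≤ R)
    (hsmall : 2 * (B * (mF * B6.c0 1 ρ ^ ν)) * R' <
      min 1 (2 / (1 / (12 * (((d + 1 : ℕ) : ℝ)) ^ 2) * (((((ℓ + 1 : ℕ) : ℝ)) ^ x.toKIdx.k) ^ (d + 1 + 1))⁻¹ *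
              min (x.toKIdx.cf ^ 2) (b₀ * x.toKIdx.cf ^ 2 / ((((ℓ + 1 : ℕ) : ℝ)) ^ x.toKIdx.k) ^ (d + 1 - 2))) +
          4 / (8 * x.toKIdx.cf ^ 2 / ((((ℓ + 1 : ℕ) : ℝ)) ^ x.toKIdx.k) ^ 2) *
            (1 + 4 * ((d + 1 : ℕ) : ℝ) * x.toKIdx.cf ^ 2 /
              (1 / (12 * (((d + 1 : ℕ) : ℝ)) ^ 2) * (((((ℓ + 1 : ℕ) : ℝ)) ^ x.toKIdx.k) ^ (d + 1 + 1))⁻¹ *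
                min (x.toKIdx.cf ^ 2) (b₀ * x.toKIdx.cf ^ 2 / ((((ℓ + 1 : ℕ) : ℝ)) ^ x.toKIdx.k) ^ (d + 1 - 2)))))⁻¹ * R)
    (hCr : 2 * (kGeo x.toKIdx).L ^ 4 * ((kGeo x.toKIdx).M * α₀) * (scaleLen (kGeo x.toKIdx).L (kGeo x.toKIdx).eta c.1.1)⁻¹ ≤ R') :
    PosDefTr (fun _ => (1 : ℝ)) (padDeltaALocY x.toKIdx (parSymY x.toKIdx) (parBY x.toKIdx) (cubeDomY x c) (cutMulY χP) (cutMulY χ) U) :=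
  posDefTr_padDeltaALocY_of_L5_of_regYP335 x c χP hχD hc hα hreg hA hρ hfib
    (coer_trIP_padDeltaALocY_one_cubeDomY_of_lev_eq_top x c hd2 hlev hb₀ hχP hχ hχD) hR' hR'R hsmall hCr

end Summit.QuantumFields.YangMills.BalabanUVNodes.N06Row17LocalClauseOnReg335OneLevel

end
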